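import Mathlib
import Summits.KontsevichZagierPeriods.Zeta5Search.BrickPropositionHInf

/-!
# BrickHoleWeightSharp — zi-p2's ADDENDUM 10⁺ (PROPOSITION 10⁺ (a)–(e), reduced form) for either kernel: the CORE hole
multiplier `ν_k = μ_k/(n^{A−2B}Ê_{K'}(0))` is digit-local one `p` deeper than `μ_k`, the hole block weight is
divisible by `p^{A+1}` (not only `p^A`), and the reduced hole sum of a row is `p^{A+1}·(an H°-instance one level
down)` (cell zeta5-irr)

HONEST FRAMING: systematic search; no irrationality claim unless certified. INSTRUMENT lemmas of the ζ(5)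
census cell zeta5-irr (HOME `run/shared/lean/pub/zeta5-irr/`; memo `zi-p2/probes/B8/thm10/ADDENDUM-10plus.md`
(sha16 24b28e98ea931eb1) PROPOSITION 10⁺ «(a) DIGIT-ZERO LAW FOR Λ° (mod p) … Λ°_K mod p depends only on
(N₀, K₀, cl) — not on K′ … (b) SHARPENED LOCALITY OF THE COMBINED WEIGHT … w_g(K′ + p^e t) ≡ w_g(K′) (mod p^{e+1})
[THEOREM 10 (ii) states mod p^e] … (c) DIVISIBILITY. w_g(K′) ≡ 0 (mod p) for every block … (d) THE WEIGHT ŵ_g :=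
w_g/p … ω̂^{hole}_g := ŵ_g·P_0 is an ADMISSIBLE weight for the row N″ … (e) HOLE-SUM LAW, SHARP FORM …
v(Σ_{K′} Σ_{cl} p^{B|ε|+c} W^{cl}_g(K′) ȓ^{cl(s)}_{K′}(n)) ≥ ℓ″ + 1»). DESIGN (tree vocabulary of `BrickHoleWeight`):
the tree's hole multiplier `μ_k = c_{k,A}(n)/c̃_{K',A}(m)` of the hole cell `k = k₀ + K'p` of the row
`n = n₀ + (m+1)p` carries the hat factor `n^{A−2B}Ê_{K'}(0)` (`Ê_{K'}(0) = (−(K'+m+1))^B(2m+1−K')^B`, an integer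
polynomial in `K'`, local only mod `p^e`); the CORE multiplier `ν_k := μ_k/(n^{A−2B}Ê_{K'}(0))` has the closed
form `ν_k·Û_k = ±(n/2−k)^ε·p^A·Ŷ_k` (unit factorials and paid class members only), hence is local mod `p^{A+e+1}`
across blocks `K' ≡ K'' (mod p^e)` for EVERY `e ≥ 0` — at `e = 0` this is (a) — and reflects exactly
(`ν_{n−k} = (−1)^ε ν_k`, as `Ê_{m−K'}(0) = Ê_{K'}(0)`). The CORE WEIGHT `w(K') = Σ_{k₀} g(k)ν_k` (zi-p2's `w_g` up to
units; `G = n^{A−2B}Ê_{K'}(0)·w` is `BrickHoleWeight.holeWeight`) is therefore local mod `p^{A+e+1}` ((b)) and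
antisymmetric mod `p^{A+L+1}`; comparing the block `K'` with its mirror `m − K'` at depth `0` gives `2w(K') ≡ 0`, i.e.
**`p^{A+1} ∣ w(K')` and `p^{A+1} ∣ G(K')`** ((c)). Finally `G/p^{A+1} = n^{A−2B}Ê·(w/p^{A+1})` is admissible for the
row `m` at every level `ℓ ≤ L` ((d)), so PROPOSITION H^∞ (`BrickPropositionHInf.propositionH_inf`) gives the SHARP
REDUCED HOLE-SUM LAW ((e), first form): `v(Σ_{K'≤m} G(K')·p^{ℓ(A−s)}c̃_{K',s}(m)) ≤ exp(−(A+ℓ+1))` for every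
`ℓ ≤ L` with `m < p^{ℓ+1}`, and the harmonic cell. NOT typed: (e)'s second form for the hole cells of the row `n`
itself (the tree's hole = hat error term `BrickLevelReductionInf.hole_cell_le` is `O(p^{A+L})`, one `p` short of
the memo's `O(p^{A+Λ})`). Nothing here is about ζ(5); filing moves no rung. Filed by the engine seat zi-eng (g10).
Statements (`p` odd, `A` even, `2B ≤ A`; row `n = n₀ + (m+1)p`, `n₀ < p`; hole digits `k₀ ∈ (n₀, p)`):
`holeCoreMult_mul_holeUnitPart` (closed form), `padicValuation_holeCoreMult_le`, **`holeCoreMult_local`**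
(`v(ν' − ν) ≤ exp(−(A+e+1))`, `J'p = Jp + p^{e+1}q`), `holeCoreMult_reflect`; `holeWeight_eq_mul_core`,
`holeCoreWeight_le`, `holeCoreWeight_reflect_add_le` (`≤ exp(−(A+L+1))`), **`holeCoreWeight_local`**
(`≤ exp(−(A+e+1))`, `p^e ∣ K'₁ − K'₂`, `0 ≤ e ≤ L`), **`holeCoreWeight_le_succ`**, **`holeWeight_le_succ`**
(`p^{A+1} ∣ w, G`), **`holeSum_sharp`** (`1 ≤ B`, `ℓ ≤ L`, `m < p^{ℓ+1}`: `≤ exp(−(A+ℓ+1))`, cells and harmonic cell).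
-/

namespace Summit.KontsevichZagierPeriods.Zeta5Search.BrickHoleWeightSharp

open Finset Nat Polynomial WithZero
open Summit.KontsevichZagierPeriods.Zeta5Search.BrickTopCoefficient (cTop cTop_reflect)
open Summit.KontsevichZagierPeriods.Zeta5Search.BrickLambda (cTop_zero_ne_zero padicValuation_two)
open Summit.KontsevichZagierPeriods.Zeta5Search.BrickResidueLawMain (cong_mul_le)
open Summit.KontsevichZagierPeriods.Zeta5Search.BrickLambdaLocality (padicValuation_sub_le_of_zmod_eq cong_pow_le
  sub_shift)
open Summit.KontsevichZagierPeriods.Zeta5Search.BrickLambdaDigit (cTop_zero_reflect cTop_reflect_le_one)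
open Summit.KontsevichZagierPeriods.Zeta5Search.BrickHatStrip (hatPoly hatPoly_eval_zero_ne_zero)
open Summit.KontsevichZagierPeriods.Zeta5Search.BrickHatMultiplier (hatPoly_eval_zero_reflect)
open Summit.KontsevichZagierPeriods.Zeta5Search.BrickHatWeight (padicValuation_hatPoly_eval_zero_le
  padicValuation_hatPoly_eval_zero_sub_le)
open Summit.KontsevichZagierPeriods.Zeta5Search.BrickHoleMultiplier (holeUnitPart holeGainPart mu_mul_holeUnitPart
  padicValuation_holeUnitPart padicValuation_holeGainPart_le)
open Summit.KontsevichZagierPeriods.Zeta5Search.BrickHoleWeight (holeParts_zmod_eq holeWeight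
  holeWeight_reflect_add_le)
open Summit.KontsevichZagierPeriods.Zeta5Search.BrickLaurent (cell)
open Summit.KontsevichZagierPeriods.Zeta5Search.BrickPartialFractions (cellZero)
open Summit.KontsevichZagierPeriods.Zeta5Search.BrickPropositionHInf (padicValuation_div_pow_le propositionH_inf)
open Literature.NumberTheory.LFunctions (padicValuation_natCast_le_one)

noncomputable section
variable {p : ℕ} [Fact p.Prime]

/-- The **CORE hole multiplier** `ν_k := μ_k/(n^{A−2B}Ê_{K'}(0))` of the hole cell `k = k₀ + K'p` of the row
`n = n₀ + (m+1)p` (`μ_k = c_{k,A}(n)/c̃_{K',A}(m)`, hat factor removed). -/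
def holeCoreMult (A B ε p n₀ m K' k₀ : ℕ) : ℚ :=
  cTop A B ε (n₀ + (m + 1) * p) (k₀ + K' * p) / cTop A B 0 m K' /
    ((((m + 1 : ℕ) : ℚ)) ^ (A - 2 * B) * (hatPoly B m K').eval 0)

/-- The **CORE hole block weight** `w(K') = Σ_{n₀ < k₀ < p} g(k₀ + K'p)·ν_{k₀+K'p}` (zi-p2's `w_g` up to units). -/
def holeCoreWeight (A B ε p n₀ m : ℕ) (g : ℕ → ℚ) (K' : ℕ) : ℚ :=
  ∑ k₀ ∈ Ico (n₀ + 1) p, g (k₀ + K' * p) * holeCoreMult A B ε p n₀ m K' k₀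

/-- `v(n/2 − x) ≤ 1` for naturals `n, x` (`p` odd). -/
theorem padicValuation_half_sub_le (hp2 : p ≠ 2) (n x : ℕ) : Rat.padicValuation p ((n : ℚ) / 2 - (x : ℚ)) ≤ 1 := by
  rw [show (n : ℚ) / 2 - (x : ℚ) = (((n : ℤ) - 2 * x : ℤ) : ℚ) / 2 by push_cast; ring, map_div₀,
    padicValuation_two hp2, div_one, Rat.padicValuation_cast]
  exact Int.padicValuation_le_one _ _

/-! ## The core multiplier: closed form, sharpened locality, reflection, size -/

section core

variable (hp2 : p ≠ 2) {A B ε n₀ i i' J M J' M' e q : ℕ} (hA : Even A) (hAB : 2 * B ≤ A) (hii : i + i' = n₀ + p)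
  (hi : i < p) (hi' : i' < p) (hn₀ : n₀ < p)

include hA hAB hii hi hi' hn₀ in
/-- **Closed form**: `ν_k·Û_k = (−1)^{nB+(m+1)B}·(n/2 − k)^ε·p^A·Ŷ_k` (`m = J + M`, `k = i + Jp`). -/
theorem holeCoreMult_mul_holeUnitPart :
    holeCoreMult A B ε p n₀ (J + M) J i * (holeUnitPart p A B n₀ i i' J M : ℚ) =
      (-1) ^ ((n₀ + (J + M + 1) * p) * B + (J + M + 1) * B) *
        ((((n₀ + (J + M + 1) * p : ℕ) : ℚ)) / 2 - ((i + J * p : ℕ) : ℚ)) ^ ε * (p : ℚ) ^ A *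
        (holeGainPart p A B n₀ i i' J M : ℚ) := by
  have hnQ : (((J + M + 1 : ℕ) : ℚ)) ≠ 0 := by positivity
  have hE : (hatPoly B (J + M) J).eval 0 ≠ 0 := hatPoly_eval_zero_ne_zero B (Nat.le_add_right J M)
  have hmu : cTop A B ε (n₀ + (J + M + 1) * p) (i + J * p) / cTop A B 0 (J + M) J * cTop A B 0 (J + M) J =
      cTop A B ε (n₀ + (J + M + 1) * p) (i + J * p) := div_mul_cancel₀ _ (cTop_zero_ne_zero (Nat.le_add_right J M) A B)
  have hL := mu_mul_holeUnitPart (p := p) hA hii hi hi' hn₀ (ε := ε) (J := J) (M := M) hmu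
  have hnA : (((J + M + 1 : ℕ) : ℚ)) ^ A = (((J + M + 1 : ℕ) : ℚ)) ^ (A - 2 * B) * (((J + M + 1 : ℕ) : ℚ)) ^ (2 * B) := by
    rw [← pow_add, Nat.sub_add_cancel hAB]
  unfold holeCoreMult
  rw [div_mul_eq_mul_div, div_eq_iff (mul_ne_zero (pow_ne_zero _ hnQ) hE)]
  refine mul_right_cancel₀ (pow_ne_zero (2 * B) hnQ) ?_
  rw [hL, hnA]; ring

variable (hJM : J' + M' = J + M) (hq : J' * p = J * p + p ^ (e + 1) * q)

include hp2 hA hAB hii hi hi' hn₀ hJM hq in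
/-- **PROPOSITION 10⁺ (a)/(b), cell level — SHARPENED LOCALITY of the core multiplier**: for the hole cells
`k = i + Jp`, `k' = i + J'p` (`J + M = J' + M' = m`, `J'p = Jp + p^{e+1}q`, any `e ≥ 0`):
`v(ν' − ν) ≤ exp(−(A+e+1))` (the memo's `Λ°_{K*} ≡ Λ°_K (mod p^{e+1})`; at `e = 0`: `ν mod p^{A+1}` depends only on
the digit). -/
theorem holeCoreMult_local :
    Rat.padicValuation p (holeCoreMult A B ε p n₀ (J + M) J' i - holeCoreMult A B ε p n₀ (J + M) J i) ≤
      exp (-((A : ℤ) + e + 1)) := by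
  have hp : p.Prime := Fact.out
  have hL := holeCoreMult_mul_holeUnitPart (p := p) (ε := ε) hA hAB hii hi hi' hn₀ (J := J) (M := M)
  have hL' := holeCoreMult_mul_holeUnitPart (p := p) (ε := ε) hA hAB hii hi hi' hn₀ (J := J') (M := M')
  rw [hJM] at hL'
  set ν : ℚ := holeCoreMult A B ε p n₀ (J + M) J i
  set ν' : ℚ := holeCoreMult A B ε p n₀ (J + M) J' i
  set s : ℚ := (-1) ^ ((n₀ + (J + M + 1) * p) * B + (J + M + 1) * B) with hs
  set c : ℚ := (((n₀ + (J + M + 1) * p : ℕ) : ℚ)) / 2 - ((i + J * p : ℕ) : ℚ) with hc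
  set c' : ℚ := (((n₀ + (J + M + 1) * p : ℕ) : ℚ)) / 2 - ((i + J' * p : ℕ) : ℚ) with hc'
  set U : ℚ := (holeUnitPart p A B n₀ i i' J M : ℚ) with hU
  set U' : ℚ := (holeUnitPart p A B n₀ i i' J' M' : ℚ) with hU'
  set Y : ℚ := (holeGainPart p A B n₀ i i' J M : ℚ) with hY
  set Y' : ℚ := (holeGainPart p A B n₀ i i' J' M' : ℚ) with hY'
  have vU : Rat.padicValuation p U = 1 := padicValuation_holeUnitPart (p := p) A B n₀ i i' J M
  have vU' : Rat.padicValuation p U' = 1 := padicValuation_holeUnitPart (p := p) A B n₀ i i' J' M'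
  have vY : Rat.padicValuation p Y ≤ 1 := padicValuation_holeGainPart_le (p := p) A B n₀ i i' J M
  have vY' : Rat.padicValuation p Y' ≤ 1 := padicValuation_holeGainPart_le (p := p) A B n₀ i i' J' M'
  have vs : Rat.padicValuation p s = 1 := by rw [hs, map_pow, Valuation.map_neg, map_one, one_pow]
  have vc : Rat.padicValuation p c ≤ 1 := padicValuation_half_sub_le hp2 _ _
  have vc' : Rat.padicValuation p c' ≤ 1 := padicValuation_half_sub_le hp2 _ _
  have hee : exp (-(((e + 1 : ℕ)) : ℤ)) = exp (-((e : ℤ) + 1)) := by push_cast; rfl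
  have vUU : Rat.padicValuation p (U - U') ≤ exp (-((e : ℤ) + 1)) := by
    rw [Valuation.map_sub_swap, ← hee]; exact padicValuation_sub_le_of_zmod_eq (holeParts_zmod_eq hp2 hJM hq).1
  have vYY : Rat.padicValuation p (Y' - Y) ≤ exp (-((e : ℤ) + 1)) := by
    rw [← hee]; exact padicValuation_sub_le_of_zmod_eq (holeParts_zmod_eq hp2 hJM hq).2
  have vcc : Rat.padicValuation p (c' - c) ≤ exp (-((e : ℤ) + 1)) := by
    have : c' - c = -((p : ℚ) ^ (e + 1) * q) := by
      have hq' : ((i + J' * p : ℕ) : ℚ) = ((i + J * p : ℕ) : ℚ) + (p : ℚ) ^ (e + 1) * q := by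
        exact_mod_cast (by rw [hq]; ring : i + J' * p = i + J * p + p ^ (e + 1) * q)
      rw [hc, hc', hq']; ring
    rw [this, Valuation.map_neg, map_mul, map_pow, Rat.padicValuation_self, ← exp_nsmul, nsmul_eq_mul, mul_neg_one]
    calc _ ≤ exp (-(((e + 1 : ℕ)) : ℤ)) * 1 := mul_le_mul' le_rfl (padicValuation_natCast_le_one q)
      _ = _ := by rw [mul_one, hee]
  have hdiff : (ν' - ν) * (U * U') = s * (p : ℚ) ^ A * (c' ^ ε * Y' * U - c ^ ε * Y * U') := by
    have e1 : ν' * U' = s * c' ^ ε * (p : ℚ) ^ A * Y' := hL'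
    have e2 : ν * U = s * c ^ ε * (p : ℚ) ^ A * Y := hL
    linear_combination U * e1 - U' * e2
  have hbr : Rat.padicValuation p (c' ^ ε * Y' * U - c ^ ε * Y * U') ≤ exp (-((e : ℤ) + 1)) := by
    refine cong_mul_le (cong_mul_le (cong_pow_le vcc vc' vc ε) vYY ?_ vY) vUU ?_ (by rw [vU'])
    · rw [map_pow]; exact pow_le_one' vc' ε
    · rw [map_mul, map_pow]; exact mul_le_one' (pow_le_one' vc' ε) vY'
  have key := congrArg (Rat.padicValuation p) hdiff
  rw [map_mul, map_mul, vU, vU', mul_one, mul_one, map_mul, map_mul, vs, one_mul, map_pow, Rat.padicValuation_self,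
    ← exp_nsmul, nsmul_eq_mul, mul_neg_one] at key
  rw [key]
  calc _ ≤ exp (-(A : ℤ)) * exp (-((e : ℤ) + 1)) := mul_le_mul' le_rfl hbr
    _ = _ := by rw [← exp_add]; congr 1; ring

end core

omit [Fact p.Prime] in
/-- **Exact reflection of the core multiplier**: `ν_{n−k} = (−1)^ε·ν_k` (hole digit `k₀ ↦ n₀ + p − k₀`, block
`K' ↦ m − K'`; `c_{n−k} = (−1)^ε c_k`, `c̃_{m−K'} = c̃_{K'}`, `Ê_{m−K'}(0) = Ê_{K'}(0)`). -/
theorem holeCoreMult_reflect {A : ℕ} (hA : Even A) (B : ℕ) {ε : ℕ} (hε : ε ≤ 1) {n₀ m K' k₀ : ℕ} (hK' : K' ≤ m)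
    (hk₀p : k₀ < p) :
    holeCoreMult A B ε p n₀ m (m - K') (n₀ + p - k₀) = (-1) ^ ε * holeCoreMult A B ε p n₀ m K' k₀ := by
  obtain ⟨M', rfl⟩ := Nat.exists_eq_add_of_le hK'
  have hkn : k₀ + K' * p ≤ n₀ + (K' + M' + 1) * p := by nlinarith
  have hrefl : n₀ + p - k₀ + (K' + M' - K') * p = n₀ + (K' + M' + 1) * p - (k₀ + K' * p) := by
    rw [Nat.add_sub_cancel_left, show (K' + M' + 1) * p = K' * p + M' * p + p by ring]; omega
  unfold holeCoreMult
  rw [hrefl, cTop_reflect_le_one hA B hε hkn, cTop_zero_reflect hA B hK', Nat.add_sub_cancel_left,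
    hatPoly_eval_zero_reflect B K' M']
  ring

/-! ## The core weight: size, reflection, sharpened locality, divisibility by `p^{A+1}` -/

section weight

variable (hp2 : p ≠ 2) {A B ε n₀ m L : ℕ} (hA : Even A) (hAB : 2 * B ≤ A) (hε : ε ≤ 1) (hn₀ : n₀ < p)
  {g : ℕ → ℚ} (hgI : ∀ k, k ≤ n₀ + (m + 1) * p → Rat.padicValuation p (g k) ≤ 1)
  (hgS : ∀ k, k ≤ n₀ + (m + 1) * p →
    Rat.padicValuation p (g (n₀ + (m + 1) * p - k) + (-1) ^ ε * g k) ≤ exp (-((L : ℤ) + 1)))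
  (hgD : ∀ e k k', 1 ≤ e → e ≤ L + 1 → k ≤ n₀ + (m + 1) * p → k' ≤ n₀ + (m + 1) * p → (p : ℤ) ^ e ∣ (k : ℤ) - k' →
    Rat.padicValuation p (g k' - g k) ≤ exp (-(e : ℤ)))

omit [Fact p.Prime] in
/-- `G(K') = (m+1)^{A−2B}·Ê_{K'}(0)·w(K')` (`K' ≤ m`). -/
theorem holeWeight_eq_mul_core {K' : ℕ} (hK' : K' ≤ m) :
    holeWeight A B ε p n₀ m g K' =
      (((m + 1 : ℕ) : ℚ)) ^ (A - 2 * B) * (hatPoly B m K').eval 0 * holeCoreWeight A B ε p n₀ m g K' := by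
  have hnQ : (((m + 1 : ℕ) : ℚ)) ≠ 0 := by positivity
  have hD : (((m + 1 : ℕ) : ℚ)) ^ (A - 2 * B) * (hatPoly B m K').eval 0 ≠ 0 :=
    mul_ne_zero (pow_ne_zero _ hnQ) (hatPoly_eval_zero_ne_zero B hK')
  unfold holeWeight holeCoreWeight holeCoreMult
  rw [Finset.mul_sum]
  exact Finset.sum_congr rfl fun k₀ _ => by rw [mul_left_comm, mul_div_cancel₀ _ hD]

include hp2 hA hAB hn₀ in
/-- `p^A ∣ ν_k`: `v(ν_k) ≤ exp(−A)` (`n₀ < k₀ < p`, `K' ≤ m`; from the closed form). -/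
theorem holeCoreMult_le {k₀ K' : ℕ} (hk₀ : n₀ < k₀) (hk₀p : k₀ < p) (hK' : K' ≤ m) :
    Rat.padicValuation p (holeCoreMult A B ε p n₀ m K' k₀) ≤ exp (-(A : ℤ)) := by
  obtain ⟨M, rfl⟩ := Nat.exists_eq_add_of_le hK'
  have key := congrArg (Rat.padicValuation p) (holeCoreMult_mul_holeUnitPart (p := p) (ε := ε) hA hAB
    (i := k₀) (i' := n₀ + p - k₀) (J := K') (M := M) (by omega) hk₀p (by omega) hn₀)
  rw [map_mul, padicValuation_holeUnitPart, mul_one, map_mul, map_mul, map_mul, map_pow, Valuation.map_neg, map_one,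
    one_pow, one_mul, map_pow (Rat.padicValuation p) (p : ℚ), Rat.padicValuation_self, ← exp_nsmul, nsmul_eq_mul,
    mul_neg_one] at key
  have hc := pow_le_one' (padicValuation_half_sub_le hp2 (n₀ + (K' + M + 1) * p) (k₀ + K' * p)) ε
  rw [← map_pow] at hc
  rw [key]
  calc _ ≤ 1 * exp (-(A : ℤ)) * 1 :=
        mul_le_mul' (mul_le_mul' hc le_rfl) (padicValuation_holeGainPart_le (p := p) A B n₀ _ _ K' M)
    _ = _ := by rw [one_mul, mul_one]

include hp2 hA hAB hn₀ hgI in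
/-- `p^A ∣ w(K')`: `v(w(K')) ≤ exp(−A)` (`K' ≤ m`). -/
theorem holeCoreWeight_le {K' : ℕ} (hK' : K' ≤ m) :
    Rat.padicValuation p (holeCoreWeight A B ε p n₀ m g K') ≤ exp (-(A : ℤ)) := by
  unfold holeCoreWeight
  refine Valuation.map_sum_le _ fun k₀ hk₀ => ?_
  have hk₀' := mem_Ico.1 hk₀
  have hkn : k₀ + K' * p ≤ n₀ + (m + 1) * p := by nlinarith
  rw [map_mul]
  calc _ ≤ 1 * exp (-(A : ℤ)) := mul_le_mul' (hgI _ hkn) (holeCoreMult_le hp2 hA hAB hn₀ (by omega) hk₀'.2 hK')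
    _ = _ := one_mul _

include hp2 hA hAB hε hn₀ hgS in
/-- **(S) for the core weight**: `v(w(m−K') + w(K')) ≤ exp(−(A+L+1))` (exact reflection `ν_{n−k} = (−1)^ε ν_k` and
(S_ε) for `g` at level `L+1`). -/
theorem holeCoreWeight_reflect_add_le {K' : ℕ} (hK' : K' ≤ m) :
    Rat.padicValuation p (holeCoreWeight A B ε p n₀ m g (m - K') + holeCoreWeight A B ε p n₀ m g K') ≤
      exp (-((A : ℤ) + L + 1)) := by
  have hp : p.Prime := Fact.out
  set n := n₀ + (m + 1) * p with hn
  unfold holeCoreWeight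
  rw [Finset.sum_Ico_eq_sum_range, Finset.sum_Ico_eq_sum_range,
    ← Finset.sum_range_reflect (fun t => g (n₀ + 1 + t + (m - K') * p) * _) (p - (n₀ + 1)), ← Finset.sum_add_distrib]
  refine Valuation.map_sum_le _ fun t ht => ?_
  have ht' := mem_range.1 ht
  have hKp : K' * p ≤ m * p := Nat.mul_le_mul_right _ hK'
  have e2 : (m + 1) * p = m * p + p := by ring
  have hkn : n₀ + 1 + t + K' * p ≤ n := by rw [hn]; omega
  have hdig : n₀ + 1 + (p - (n₀ + 1) - 1 - t) = n₀ + p - (n₀ + 1 + t) := by omega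
  have hrefl : n₀ + p - (n₀ + 1 + t) + (m - K') * p = n - (n₀ + 1 + t + K' * p) := by
    rw [hn, Nat.sub_mul, add_mul, one_mul]; omega
  rw [hdig, hrefl, holeCoreMult_reflect hA B hε hK' (by omega),
    show g (n - (n₀ + 1 + t + K' * p)) * ((-1) ^ ε * holeCoreMult A B ε p n₀ m K' (n₀ + 1 + t)) +
        g (n₀ + 1 + t + K' * p) * holeCoreMult A B ε p n₀ m K' (n₀ + 1 + t) =
      ((-1) ^ ε * holeCoreMult A B ε p n₀ m K' (n₀ + 1 + t)) *
        (g (n - (n₀ + 1 + t + K' * p)) + (-1) ^ ε * g (n₀ + 1 + t + K' * p)) by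
      rcases Nat.le_one_iff_eq_zero_or_eq_one.1 hε with h | h <;> subst h <;> ring, map_mul, map_mul, map_pow,
    Valuation.map_neg, map_one, one_pow, one_mul]
  calc _ ≤ exp (-(A : ℤ)) * exp (-((L : ℤ) + 1)) :=
        mul_le_mul' (holeCoreMult_le hp2 hA hAB hn₀ (by omega) (by omega) hK') (hgS _ hkn)
    _ = _ := by rw [← exp_add]; congr 1; ring

include hp2 hA hAB hn₀ hgI hgD in
/-- **PROPOSITION 10⁺ (b) — SHARPENED (D) for the core weight**: `v(w(K'₂) − w(K'₁)) ≤ exp(−(A+e+1))` for blocks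
`K'₁, K'₂ ≤ m` with `p^e ∣ K'₁ − K'₂`, every `0 ≤ e ≤ L` ((D)_{e+1} for `g`, `holeCoreMult_local` for `ν`). -/
theorem holeCoreWeight_local {e K₁ K₂ : ℕ} (heL : e ≤ L) (hK₁ : K₁ ≤ m) (hK₂ : K₂ ≤ m)
    (hdvd : (p : ℤ) ^ e ∣ (K₁ : ℤ) - K₂) :
    Rat.padicValuation p (holeCoreWeight A B ε p n₀ m g K₂ - holeCoreWeight A B ε p n₀ m g K₁) ≤
      exp (-((A : ℤ) + e + 1)) := by
  have hp : p.Prime := Fact.out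
  wlog hle : K₁ ≤ K₂ generalizing K₁ K₂
  · rw [Valuation.map_sub_swap]
    exact this hK₂ hK₁ (by rw [← neg_sub]; exact (dvd_neg).2 hdvd) (by omega)
  obtain ⟨d, rfl⟩ := Nat.exists_eq_add_of_le hle
  obtain ⟨q, hq⟩ : p ^ e ∣ d := by
    have : (p : ℤ) ^ e ∣ (d : ℤ) := by
      have h := (dvd_neg).2 hdvd
      rw [neg_sub] at h; push_cast at h; rwa [add_sub_cancel_left] at h
    exact_mod_cast this
  obtain ⟨M₂, hM₂⟩ := Nat.exists_eq_add_of_le hK₂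
  obtain ⟨M₁, hM₁⟩ := Nat.exists_eq_add_of_le hK₁
  unfold holeCoreWeight
  rw [← Finset.sum_sub_distrib]
  refine Valuation.map_sum_le _ fun k₀ hk₀ => ?_
  have hk₀' := mem_Ico.1 hk₀
  have hkn : k₀ + K₁ * p ≤ n₀ + (m + 1) * p := by nlinarith
  have hkn' : k₀ + (K₁ + d) * p ≤ n₀ + (m + 1) * p := by nlinarith
  rw [show g (k₀ + (K₁ + d) * p) * holeCoreMult A B ε p n₀ m (K₁ + d) k₀ - g (k₀ + K₁ * p) * holeCoreMult A B ε p n₀ m K₁ k₀ =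
    g (k₀ + (K₁ + d) * p) * (holeCoreMult A B ε p n₀ m (K₁ + d) k₀ - holeCoreMult A B ε p n₀ m K₁ k₀) +
    (g (k₀ + (K₁ + d) * p) - g (k₀ + K₁ * p)) * holeCoreMult A B ε p n₀ m K₁ k₀ by ring]
  refine Valuation.map_add_le _ ?_ ?_
  · rw [map_mul]
    have hν := holeCoreMult_local hp2 (A := A) (B := B) (ε := ε) (n₀ := n₀) (i := k₀) (i' := n₀ + p - k₀) (J := K₁)
      (M := M₁) (J' := K₁ + d) (M' := M₂) (e := e) (q := q) hA hAB (by omega) hk₀'.2 (by omega) hn₀ (by omega)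
      (by rw [hq]; ring)
    rw [← hM₁] at hν
    calc _ ≤ 1 * exp (-((A : ℤ) + e + 1)) := mul_le_mul' (hgI _ hkn') hν
      _ = _ := one_mul _
  · rw [map_mul]
    have hg := hgD (e + 1) (k₀ + K₁ * p) (k₀ + (K₁ + d) * p) (by omega) (by omega) hkn hkn' (by
      rw [hq]; push_cast; exact ⟨-(q : ℤ), by ring⟩)
    calc _ ≤ exp (-(((e + 1 : ℕ)) : ℤ)) * exp (-(A : ℤ)) :=
          mul_le_mul' hg (holeCoreMult_le hp2 hA hAB hn₀ (by omega) hk₀'.2 hK₁)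
      _ = _ := by rw [← exp_add]; congr 1; push_cast; ring

include hp2 hA hAB hε hn₀ hgI hgS hgD in
/-- **PROPOSITION 10⁺ (c) — `p^{A+1} ∣ w(K')`**: `v(w(K')) ≤ exp(−(A+1))` (`K' ≤ m`): `w(K') ≡ w(m−K')
(mod p^{A+1})` by locality at depth `0`, `w(m−K') ≡ −w(K') (mod p^{A+L+1})` by (S), and `p` is odd. -/
theorem holeCoreWeight_le_succ {K' : ℕ} (hK' : K' ≤ m) :
    Rat.padicValuation p (holeCoreWeight A B ε p n₀ m g K') ≤ exp (-((A : ℤ) + 1)) := by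
  have hS := holeCoreWeight_reflect_add_le hp2 hA hAB (ε := ε) hε hn₀ (L := L) hgS hK'
  have hD := holeCoreWeight_local hp2 hA hAB (ε := ε) hn₀ (L := L) hgI hgD (e := 0) (K₁ := K') (K₂ := m - K')
    (Nat.zero_le L)
    hK' (Nat.sub_le m K') (by rw [pow_zero]; exact one_dvd _)
  have h2 : Rat.padicValuation p (2 * holeCoreWeight A B ε p n₀ m g K') ≤ exp (-((A : ℤ) + 1)) := by
    rw [show 2 * holeCoreWeight A B ε p n₀ m g K' =
      (holeCoreWeight A B ε p n₀ m g (m - K') + holeCoreWeight A B ε p n₀ m g K') -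
        (holeCoreWeight A B ε p n₀ m g (m - K') - holeCoreWeight A B ε p n₀ m g K') by ring]
    refine Valuation.map_sub_le _ (hS.trans (exp_le_exp.2 (by omega))) (hD.trans (exp_le_exp.2 (by omega)))
  rwa [map_mul, padicValuation_two hp2, one_mul] at h2

include hp2 hA hAB hε hn₀ hgI hgS hgD in
/-- **PROPOSITION 10⁺ (c) for the tree's hole weight — `p^{A+1} ∣ G(K')`**: `v(G(K')) ≤ exp(−(A+1))` (`K' ≤ m`;
`BrickHoleWeight.holeWeight_le` gives `exp(−A)`). -/
theorem holeWeight_le_succ {K' : ℕ} (hK' : K' ≤ m) :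
    Rat.padicValuation p (holeWeight A B ε p n₀ m g K') ≤ exp (-((A : ℤ) + 1)) := by
  rw [holeWeight_eq_mul_core hK', map_mul, map_mul, map_pow]
  calc _ ≤ 1 ^ (A - 2 * B) * 1 * exp (-((A : ℤ) + 1)) :=
        mul_le_mul' (mul_le_mul' (pow_le_pow_left' (padicValuation_natCast_le_one _) _)
          (padicValuation_hatPoly_eval_zero_le B m K')) (holeCoreWeight_le_succ hp2 hA hAB hε hn₀ hgI hgS hgD hK')
    _ = _ := by rw [one_pow, one_mul, one_mul]

/-! ## PROPOSITION 10⁺ (d)/(e): the sharp reduced hole-sum law -/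

include hp2 hA hAB hε hn₀ hgI hgS hgD in
/-- **PROPOSITION 10⁺ (d)+(e) (reduced form) — THE SHARP HOLE-SUM LAW**: for `1 ≤ B` and every level `ℓ ≤ L` with
`m < p^{ℓ+1}`, the weight `G/p^{A+1}` is admissible for the row `m` at level `ℓ` ((I) by (c), (S) from
`holeWeight_reflect_add_le`, (D) from `holeCoreWeight_local` and the locality of `Ê_{K'}(0)`), so PROPOSITION H^∞
gives `v(Σ_{K'≤m} G(K')·p^{ℓ(A−s)}c̃_{K',s}(m)) ≤ exp(−(A+ℓ+1))` for every `s`, and the harmonic cell. -/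
theorem holeSum_sharp (hB : 1 ≤ B) {ℓ : ℕ} (hℓ : ℓ ≤ L) (hm : m < p ^ (ℓ + 1)) :
    (∀ s, Rat.padicValuation p (∑ K ∈ range (m + 1),
      holeWeight A B ε p n₀ m g K * ((p : ℚ) ^ (ℓ * (A - s)) * cell A B 0 m K s)) ≤ exp (-((A : ℤ) + ℓ + 1))) ∧
    Rat.padicValuation p (∑ K ∈ range (m + 1),
      holeWeight A B ε p n₀ m g K * ((p : ℚ) ^ (ℓ * A) * cellZero A B 0 m K)) ≤ exp (-((A : ℤ) + ℓ + 1)) := by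
  have hp : p.Prime := Fact.out
  have hpQ : (p : ℚ) ≠ 0 := by exact_mod_cast hp.ne_zero
  have hpA : (p : ℚ) ^ (A + 1) ≠ 0 := pow_ne_zero _ hpQ
  set G : ℕ → ℚ := holeWeight A B ε p n₀ m g with hG
  set ω : ℕ → ℚ := fun K => G K / (p : ℚ) ^ (A + 1) with hω
  have hGω : ∀ K, G K = (p : ℚ) ^ (A + 1) * ω K := fun K => by rw [hω]; simp only; rw [mul_div_cancel₀ _ hpA]
  have hωI : ∀ K, K ≤ m → Rat.padicValuation p (ω K) ≤ 1 := fun K hK => by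
    have h := padicValuation_div_pow_le (p := p) (A + 1) (holeWeight_le_succ hp2 hA hAB hε hn₀ (L := L) hgI hgS hgD hK)
    rw [show -((A : ℤ) + 1) + ((A + 1 : ℕ) : ℤ) = 0 by push_cast; ring, exp_zero] at h
    simpa only [hω, hG] using h
  have hωS : ∀ K, K ≤ m → Rat.padicValuation p (ω (m - K) + ω K) ≤ exp (-(ℓ : ℤ)) := fun K hK => by
    have h := padicValuation_div_pow_le (p := p) (A + 1)
      (holeWeight_reflect_add_le hp2 hA hAB (ε := ε) hε hn₀ (L := L) hgS hK)
    have h' : Rat.padicValuation p ((G (m - K) + G K) / (p : ℚ) ^ (A + 1)) ≤ exp (-(ℓ : ℤ)) := by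
      rw [hG]; exact h.trans (exp_le_exp.2 (by push_cast; omega))
    simpa only [hω, add_div] using h'
  have hωD : ∀ e K K', 1 ≤ e → e ≤ ℓ → K ≤ m → K' ≤ m → (p : ℤ) ^ e ∣ (K : ℤ) - K' →
      Rat.padicValuation p (ω K' - ω K) ≤ exp (-(e : ℤ)) := fun e K K' _ heℓ hK hK' hdvd => by
    have hn1 : Rat.padicValuation p ((((m + 1 : ℕ) : ℚ)) ^ (A - 2 * B)) ≤ 1 := by
      rw [map_pow]; exact pow_le_one' (padicValuation_natCast_le_one _) _
    have hx : ∀ K, K ≤ m → ω K = ((((m + 1 : ℕ) : ℚ)) ^ (A - 2 * B) * (hatPoly B m K).eval 0) *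
        (holeCoreWeight A B ε p n₀ m g K / (p : ℚ) ^ (A + 1)) := fun K hK => by
      rw [hω]; simp only; rw [hG, holeWeight_eq_mul_core hK, mul_div_assoc]
    rw [hx K hK, hx K' hK']
    refine cong_mul_le ?_ ?_ (by rw [map_mul]; exact mul_le_one' hn1 (padicValuation_hatPoly_eval_zero_le B m K')) ?_
    · rw [← mul_sub, map_mul]
      calc _ ≤ 1 * exp (-(e : ℤ)) := mul_le_mul' hn1 (padicValuation_hatPoly_eval_zero_sub_le (p := p) B m hdvd)
        _ = _ := one_mul _
    · rw [← sub_div]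
      have h := padicValuation_div_pow_le (p := p) (A + 1)
        (holeCoreWeight_local hp2 hA hAB (ε := ε) hn₀ (L := L) hgI hgD (heℓ.trans hℓ) hK hK' hdvd)
      exact h.trans (exp_le_exp.2 (by push_cast; omega))
    · have h := padicValuation_div_pow_le (p := p) (A + 1)
        (holeCoreWeight_le_succ hp2 hA hAB hε hn₀ (L := L) hgI hgS hgD hK)
      rwa [show -((A : ℤ) + 1) + ((A + 1 : ℕ) : ℤ) = 0 by push_cast; ring, exp_zero] at h
  obtain ⟨Hs, H0⟩ := propositionH_inf hp2 hA hB hAB ℓ m hm ω hωI hωS hωD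
  have hpvA : Rat.padicValuation p ((p : ℚ) ^ (A + 1)) = exp (-((A : ℤ) + 1)) := by
    rw [map_pow, Rat.padicValuation_self, ← exp_nsmul, nsmul_eq_mul, mul_neg_one]; push_cast; rfl
  refine ⟨fun s => ?_, ?_⟩
  · rw [show ∑ K ∈ range (m + 1), G K * ((p : ℚ) ^ (ℓ * (A - s)) * cell A B 0 m K s) =
      (p : ℚ) ^ (A + 1) * ∑ K ∈ range (m + 1), ω K * ((p : ℚ) ^ (ℓ * (A - s)) * cell A B 0 m K s) by
        rw [Finset.mul_sum]; exact Finset.sum_congr rfl fun K _ => by rw [hGω K]; ring, map_mul, hpvA]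
    calc _ ≤ exp (-((A : ℤ) + 1)) * exp (-(ℓ : ℤ)) := mul_le_mul' le_rfl (Hs s)
      _ = _ := by rw [← exp_add]; congr 1; ring
  · rw [show ∑ K ∈ range (m + 1), G K * ((p : ℚ) ^ (ℓ * A) * cellZero A B 0 m K) =
      (p : ℚ) ^ (A + 1) * ∑ K ∈ range (m + 1), ω K * ((p : ℚ) ^ (ℓ * A) * cellZero A B 0 m K) by
        rw [Finset.mul_sum]; exact Finset.sum_congr rfl fun K _ => by rw [hGω K]; ring, map_mul, hpvA]
    calc _ ≤ exp (-((A : ℤ) + 1)) * exp (-(ℓ : ℤ)) := mul_le_mul' le_rfl H0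
      _ = _ := by rw [← exp_add]; congr 1; ring

end weight

end
end Summit.KontsevichZagierPeriods.Zeta5Search.BrickHoleWeightSharp
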